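import Literature.NumberTheory.PAdicHodge.AinfRamifiedPTorsionZero
import Literature.NumberTheory.PAdicHodge.AinfWeierstrassRamifiedTorsionSeparation
import HarnessLib

/-!
# (L2′) over the ramified base, ϖ-SHAPE version: `[p]T = 0, T ∈ 𝔫_𝒪 ⇒ T ∈ ϖ·A_inf(𝒪) ⇒ θ_𝒪(T) = 0` (proofs only)

Topic `Literature/NumberTheory/PAdicHodge`; namespace `Literature.NumberTheory.PAdicHodge.AinfRamTop`. THEOREMS ONLY (no definition,
no named fact, no instance, no `sorry`). Sequel of `AinfRamifiedPTorsionZero` (§1: `𝔫_𝒪 ⊆ Jac`, units of the form `c + a·y`),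
`AinfRamifiedVarpi` (`ϖ ∣ x^n ⇒ ϖ ∣ x` in `A_inf(𝒪)`), `AinfWeierstrassRamifiedTorsionSeparation` (no nonzero `p`-torsion of
`Ŵ(𝔪_{ℂ_F})` of norm `≤ ‖ϖ‖`) and `EisensteinRootShortModelShape` (the ϖ-shape of `[p]` for the K★ cell models).

WHY. `AinfRamifiedPTorsionZero.eq_zero_of_mulP_eq_zero` assumes the shape `[p] = p·X·R + X^{p²}·S` with `R(0), S(0) ∈ 𝒪_Dˣ`, which
holds for `ℤ`-models but NOT for the good `𝒪_D`-models of curves with additive potentially supersingular reduction (`[X^p][p] ≡ A_p`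
is divisible by `ϖ^r`, not by `p = ϖ^e`; e.g. `A_5 = 32a·ϱ` on the (5; IV*) cell). What does hold is the ϖ-SHAPE
`[p](X) = ϱ·X·Q(X) + X^{p²}·S(X)`, `S(0) ≡ −1 (mod ϱ)` (height `2` of the reduction over `𝔽_p`). This file runs (L2′) from it:

* `coe_mulP_eq_of_varpi_shape` — `[p](a) = ϱ·a·Q(a) + a^{p²}·S(a)` on `Ŵ(𝔫_𝒪)`;
* `isUnit_evalAt_of_constantCoeff_add_one_mem` — `S(a)` is a unit when `S(0) + 1 ∈ (ϱ)` (`ϱ, a ∈ 𝔫_𝒪 ⊆ Jac`);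
* **`exists_eq_varpi_mul_of_mulP_eq_zero`** — `[p]T = 0`, `T ∈ 𝔫_𝒪` ⇒ `T = ϱ·T₁` (`T^{p²}·S(T) = −ϱ·T·Q(T)`, reducedness of
  `A_inf(𝒪)/ϱ`); **`norm_theta_le_of_mulP_eq_zero`** — hence `‖θ_𝒪(T)‖ ≤ ‖ϖ‖`;
* **`theta_eq_zero_of_mulP_eq_zero`** — if moreover `A_p(W) ∈ ϱ^r·𝒪_D`, `e < 2p − 1`, `e < r + (p − 1)` (`D.poly = X^e − p`, `p`
  odd), then `θ_𝒪(T) = 0`: `θ_𝒪(T)` is a `p`-torsion point of `Ŵ(𝔪_{ℂ_F})` (`theta_mulP`) of norm `≤ ‖ϖ‖`, so it vanishes by the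
  separation theorem. (Over `ℤ` the conclusion was `θ(T) ∈ p𝒪_C`; here `θ(T) = 0`.)
* `theta_torsionLift_eq_zero_of_mulP_eq_zero` — the same for Fontaine's element `[τ]` of a `[p]`-compatible sequence.

This is the ring-side half of the ω-period non-vanishing (N1′) on the K★ cells: `∫_τ ω = 0 ⇒ [τ] = 0`
(`AinfRamifiedOmegaPeriodVanishing`) `⇒ [p][τ′] = 0 ⇒ θ_𝒪[τ′] = τ₁ = 0`. BSD is not proved by any of this.

## References
* [SilvermanAEC2009] J. H. Silverman, *AEC* (2009), IV.4.4, IV.7.5.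
* [FarguesFontaine2018] L. Fargues, J.-M. Fontaine, Astérisque 406 (2018), §2.2.
* [Serre1967GroupesPDivisibles] J.-P. Serre, Sém. Bourbaki 318, §5 Lemme 3.
-/

noncomputable section

open Ideal Field ValuativeRel

namespace Literature.NumberTheory.PAdicHodge

open Literature.NumberTheory.GaloisRepresentations
open Literature.NumberTheory.GaloisRepresentations.IsNonarchimedeanLocalField
open Literature.NumberTheory.GaloisRepresentations.LubinTate

namespace AinfRamTop

variable {F : Type} [Field F] [ValuativeRel F] [TopologicalSpace F] [IsNonarchimedeanLocalField F] [CharZero F]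
  {p : ℕ} [Fact p.Prime] [Fact (¬ IsUnit (p : integerC F))] [IsAdicComplete (Ideal.span {(p : integerC F)}) (integerC F)]
  {hp : valuation F p < 1} {D : EisensteinRoot F p hp}
  {hθ : Function.Surjective (WittVector.fontaineTheta (integerC F) p)} (W : WeierstrassCurve (EisensteinRoot.CoeffDisc D))

/-- **`[p](a) = ϱ·a·Q(a) + a^{p²}·S(a)` on points of `𝔫_𝒪`**, for the ϖ-shape `[p] = ϱ·X·Q + X^{p²}·S`.
[cite: SilvermanAEC2009, IV.7.5] -/
theorem coe_mulP_eq_of_varpi_shape {Q S : PowerSeries (EisensteinRoot.CoeffDisc D)}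
    (hshape : W.formalMul p = PowerSeries.C (EisensteinRoot.CoeffDisc.of D (AdjoinRoot.root D.poly)) * PowerSeries.X * Q +
      PowerSeries.X ^ (p ^ 2) * S) (a : (nilTheta D hθ).toIdeal) :
    (mulP W a : AinfRamTop D) =
      of D (AinfRam.varpi D) * a * evalAt (nilTheta D hθ) a Q + (a : AinfRamTop D) ^ (p ^ 2) * evalAt (nilTheta D hθ) a S := by
  rw [mulP, coe_evalPt₁_eq_evalAt, hshape, map_add, map_mul, map_mul, map_mul, map_pow, evalAt_nilTheta_C, evalAt_nilTheta_X,
    EisensteinRoot.algebraMap_coeffDisc_ainfRamTop, AinfRam.coeffHom_root]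

/-- **`S(a)` is a unit for `S(0) + 1 ∈ (ϱ)`** and `a ∈ 𝔫_𝒪`: `S(a) = −1 + (ϱ·c + a·S₁(a))` with `ϱ, a ∈ 𝔫_𝒪 ⊆ Jac(A_inf(𝒪))`.
[cite: FarguesFontaine2018, §2.2] -/
theorem isUnit_evalAt_of_constantCoeff_add_one_mem (a : (nilTheta D hθ).toIdeal) {S : PowerSeries (EisensteinRoot.CoeffDisc D)}
    (hS : PowerSeries.constantCoeff S + 1 ∈ Ideal.span {EisensteinRoot.CoeffDisc.of D (AdjoinRoot.root D.poly)}) :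
    IsUnit (evalAt (nilTheta D hθ) a S) := by
  obtain ⟨c, hc⟩ := Ideal.mem_span_singleton'.1 hS
  have hS0 : PowerSeries.constantCoeff S = -1 + c * EisensteinRoot.CoeffDisc.of D (AdjoinRoot.root D.poly) := by
    rw [hc]; ring
  rw [evalAt_eq_algebraMap_add_mul, hS0, map_add, map_mul, EisensteinRoot.algebraMap_coeffDisc_ainfRamTop, AinfRam.coeffHom_root,
    add_assoc]
  have hmem : algebraMap (EisensteinRoot.CoeffDisc D) (AinfRamTop D) c * of D (AinfRam.varpi D) +
      (a : AinfRamTop D) * evalAt (nilTheta D hθ) a (PowerSeries.mk fun n => PowerSeries.coeff (n + 1) S) ∈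
        (nilTheta D hθ).toIdeal :=
    Ideal.add_mem _ (Ideal.mul_mem_left _ _ of_varpi_mem_nilTheta) (Ideal.mul_mem_right _ _ a.2)
  have h := isUnit_algebraMap_add_mul (D := D) (hθ := hθ) (c := (-1 : EisensteinRoot.CoeffDisc D)) isUnit_one.neg hmem 1
  rwa [mul_one] at h

/-- **(L2′, ϖ-shape) `[p]T = 0, T ∈ 𝔫_𝒪 ⟹ T ∈ ϱ·A_inf(𝒪)`**: `T^{p²}·S(T) = −ϱ·T·Q(T)` with `S(T)` a unit, so `ϱ ∣ T^{p²}`,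
hence `ϱ ∣ T` (`A_inf(𝒪)/ϱ = 𝒪_{C♭}` is reduced). [cite: FarguesFontaine2018, §2.2] [cite: SilvermanAEC2009, IV.7.5] -/
theorem exists_eq_varpi_mul_of_mulP_eq_zero {Q S : PowerSeries (EisensteinRoot.CoeffDisc D)}
    (hshape : W.formalMul p = PowerSeries.C (EisensteinRoot.CoeffDisc.of D (AdjoinRoot.root D.poly)) * PowerSeries.X * Q +
      PowerSeries.X ^ (p ^ 2) * S)
    (hS : PowerSeries.constantCoeff S + 1 ∈ Ideal.span {EisensteinRoot.CoeffDisc.of D (AdjoinRoot.root D.poly)})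
    {T : (nilTheta D hθ).toIdeal} (hT : (mulP W T : AinfRamTop D) = 0) :
    ∃ T₁ : AinfRamTop D, (T : AinfRamTop D) = of D (AinfRam.varpi D) * T₁ := by
  have h1 := coe_mulP_eq_of_varpi_shape W hshape T
  rw [hT] at h1
  obtain ⟨u, hu⟩ := isUnit_evalAt_of_constantCoeff_add_one_mem (D := D) (hθ := hθ) T hS
  -- `T^{p²} = ϱ · (−T·Q(T)·u⁻¹)`
  have h2 : (T : AinfRamTop D) ^ (p ^ 2) = of D (AinfRam.varpi D) * (-(T : AinfRamTop D) * evalAt (nilTheta D hθ) T Q * ↑u⁻¹) := by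
    have h3 : (T : AinfRamTop D) ^ (p ^ 2) * evalAt (nilTheta D hθ) T S = -(of D (AinfRam.varpi D) * T * evalAt (nilTheta D hθ) T Q) :=
      eq_neg_of_add_eq_zero_right h1.symm
    rw [← hu] at h3
    calc (T : AinfRamTop D) ^ (p ^ 2) = (T : AinfRamTop D) ^ (p ^ 2) * u * ↑u⁻¹ := by rw [mul_assoc, Units.mul_inv, mul_one]
      _ = _ := by rw [h3]; ring
  -- `ϖ ∣ T` in `A_inf(𝒪)`
  have hdvd : AinfRam.varpi D ∣ ((of D).symm T) ^ (p ^ 2) := by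
    refine ⟨(of D).symm (-(T : AinfRamTop D) * evalAt (nilTheta D hθ) T Q * ↑u⁻¹), ?_⟩
    have := congrArg (of D).symm h2
    rwa [map_pow, map_mul, RingEquiv.symm_apply_apply] at this
  obtain ⟨T₁, hT₁⟩ := AinfRam.varpi_dvd_of_varpi_dvd_pow D hdvd
  refine ⟨of D T₁, ?_⟩
  have := congrArg (of D) hT₁
  rwa [RingEquiv.apply_symm_apply, map_mul] at this

/-- **`‖θ_𝒪(T)‖ ≤ ‖ϖ‖`** for `T ∈ Ŵ(𝔫_𝒪)` with `[p]T = 0` (ϖ-shape). [cite: FarguesFontaine2018, §2.2] -/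
theorem norm_theta_le_of_mulP_eq_zero {Q S : PowerSeries (EisensteinRoot.CoeffDisc D)}
    (hshape : W.formalMul p = PowerSeries.C (EisensteinRoot.CoeffDisc.of D (AdjoinRoot.root D.poly)) * PowerSeries.X * Q +
      PowerSeries.X ^ (p ^ 2) * S)
    (hS : PowerSeries.constantCoeff S + 1 ∈ Ideal.span {EisensteinRoot.CoeffDisc.of D (AdjoinRoot.root D.poly)})
    {T : (nilTheta D hθ).toIdeal} (hT : (mulP W T : AinfRamTop D) = 0) :
    ‖((theta D (T : AinfRamTop D) : CBall F) : CompletedAlgClosure F)‖ ≤ ‖((D.rootC : integerC F) : CompletedAlgClosure F)‖ := by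
  obtain ⟨T₁, hT₁⟩ := exists_eq_varpi_mul_of_mulP_eq_zero W hshape hS hT
  rw [hT₁, map_mul, Subring.coe_mul, norm_mul, coe_theta, AinfRam.theta_varpi]
  exact mul_le_of_le_one_right (norm_nonneg _) (NumberTheory.EllipticCurves.norm_coe_unitBall_le_one _)

/-- **(L2′) `[p]T = 0, T ∈ 𝔫_𝒪 ⟹ θ_𝒪(T) = 0`** for `W` over `𝒪_D = ℤ_p[X]/(X^e − p)` (`p` odd) with the ϖ-shape of `[p]`,
`A_p(W) ∈ ϱ^r·𝒪_D`, `e < 2p − 1`, `e < r + (p − 1)`: `θ_𝒪(T)` is a `p`-torsion point of `Ŵ(𝔪_{ℂ_F})` of norm `≤ ‖ϖ‖`, hence `0`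
(`mulPC_ne_zero_of_norm_le_of_hasseCoeff`). [cite: SilvermanAEC2009, IV.4.4 and IV.7.5] [cite: FarguesFontaine2018, §2.2] -/
theorem theta_eq_zero_of_mulP_eq_zero {e : ℕ} (hD : D.poly = Polynomial.X ^ e - Polynomial.C (p : ℤ_[p])) (hp2 : p ≠ 2)
    {Q S : PowerSeries (EisensteinRoot.CoeffDisc D)}
    (hshape : W.formalMul p = PowerSeries.C (EisensteinRoot.CoeffDisc.of D (AdjoinRoot.root D.poly)) * PowerSeries.X * Q +
      PowerSeries.X ^ (p ^ 2) * S)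
    (hS : PowerSeries.constantCoeff S + 1 ∈ Ideal.span {EisensteinRoot.CoeffDisc.of D (AdjoinRoot.root D.poly)})
    {r : ℕ} {c : EisensteinRoot.CoeffDisc D} (hA : W.hasseCoeff p = EisensteinRoot.CoeffDisc.of D (AdjoinRoot.root D.poly ^ r) * c)
    (he2 : e < 2 * p - 1) (her : e < r + (p - 1))
    {T : (nilTheta D hθ).toIdeal} (hT : (mulP W T : AinfRamTop D) = 0) :
    ((theta D (T : AinfRamTop D) : CBall F) : CompletedAlgClosure F) = 0 := by
  by_contra h0
  have hle := norm_theta_le_of_mulP_eq_zero W hshape hS hT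
  have hpt : ((mulPC W ⟨theta D (T : AinfRamTop D), theta_mem_maxNilIdealC T.2⟩ : (maxNilIdealC F).toIdeal) : CBall F) = 0 := by
    rw [← theta_mulP, hT, map_zero]
  exact mulPC_ne_zero_of_norm_le_of_hasseCoeff W hD hp2 hA he2 her ⟨theta D (T : AinfRamTop D), theta_mem_maxNilIdealC T.2⟩ h0
    hle hpt

/-- **The same for Fontaine's element `[τ]`** of a `[p]`-compatible sequence `τ` of torsion points: if `[p][τ] = 0` in
`Ŵ(𝔫_𝒪)` then `θ_𝒪[τ] = 0`. [cite: SilvermanAEC2009, IV.7.5] [cite: FarguesFontaine2018, §2.2] -/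
theorem theta_torsionLift_eq_zero_of_mulP_eq_zero {e : ℕ} (hD : D.poly = Polynomial.X ^ e - Polynomial.C (p : ℤ_[p]))
    (hp2 : p ≠ 2) {Q S : PowerSeries (EisensteinRoot.CoeffDisc D)}
    (hshape : W.formalMul p = PowerSeries.C (EisensteinRoot.CoeffDisc.of D (AdjoinRoot.root D.poly)) * PowerSeries.X * Q +
      PowerSeries.X ^ (p ^ 2) * S)
    (hS : PowerSeries.constantCoeff S + 1 ∈ Ideal.span {EisensteinRoot.CoeffDisc.of D (AdjoinRoot.root D.poly)})
    {r : ℕ} {c : EisensteinRoot.CoeffDisc D} (hA : W.hasseCoeff p = EisensteinRoot.CoeffDisc.of D (AdjoinRoot.root D.poly ^ r) * c)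
    (he2 : e < 2 * p - 1) (her : e < r + (p - 1))
    {t : ℕ → (maxNilIdealC F).toIdeal} (htp : ∀ n, mulPC W (t (n + 1)) = t n)
    (h : (mulP W ⟨torsionLift W hθ t htp, flim_mem_nilTheta _ _⟩ : AinfRamTop D) = 0) :
    ((theta D (torsionLift W hθ t htp) : CBall F) : CompletedAlgClosure F) = 0 :=
  theta_eq_zero_of_mulP_eq_zero W hD hp2 hshape hS hA he2 her h

end AinfRamTop

end Literature.NumberTheory.PAdicHodge

end
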